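import Literature.NumberTheory.Automorphic.UnitaryGroupLocalNormFormCoercive
import HarnessLib

/-!
# The EXPANSION PROPERTY of `U(J)(F_v)` on `𝕎_v = Res(E_vᴺ)` at a NON-SPLIT place: every open subgroup moves every far-out
# vector by a small vector with non-trivial Heisenberg phase

Topic `NumberTheory/Automorphic`; namespace `Literature.NumberTheory.Automorphic.UnitaryGroup`.  KERNEL ONLY: theorems; no
definition, no named fact, no record, no `sorry`.  Sequel of `UnitaryGroupLocalReflections.lean` and
`UnitaryGroupLocalNormFormCoercive.lean`.

Setting as there (`E/F` quadratic number fields, `c`, `δ`, `d`, `T` symmetric with `det T` a unit, `J = T ⊗ 1`, a finite place `v`,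
`E_v = E ⊗_F F_v` with coordinates `re`, `im`, the local unitary group `U(J)(F_v)` in its factor form `localPi`, the embedding
`ι_v` into `Sp(𝕎_v)`), now with `E_v` a FIELD (`v` non-split in `E`).  MAIN RESULT (**`exists_expansion_of_isField`**, §4): for
every open subgroup `K ≤ U(J)(F_v)` and every target box `(𝔭_v^n)^{2N} ⊆ 𝕎_v` there is a box `Ω = (𝔭_v^{-M})^{2N}` such that every
`w ∉ Ω` is moved by some `k ∈ K` by a vector `ι_v(k) w - w ∈ (𝔭_v^n)^{2N}` whose Heisenberg phase
`ψ_v(½ (B(ι_v(k) w, ι_v(k) w) - B(w, w)) - B(w, ι_v(k) w - w))` is NOT `1` (`B = polar β_{𝕋_v}`, `ψ_v = adeleAddCharAt F v`).  This is the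
group-side input of the lattice-model support bound for theta lifts from the compact `U(1)` ([MoeglinVignerasWaldspurger1987,
Chap. 2 II.8, Chap. 3 IV]; [Howe1979, §2]); it FAILS at split places (there `U(J)(F_v) ≅ GL_N(F_v)` preserves a Lagrangian).

Mechanism (sizes `s(z) = max(|re z|, |im z|)` in the coordinates `E_v = F_v ⊕ F_v δ`, a `K`-norm [WeilBNT1967, Chap. II §1]):
the Heisenberg phase of a symplectic move `g w = w + y` is `½ A(y, w) + ½ B(y, y)` (`ofSymplectic_f_sub_eq`); for the
quasi-reflection `r = 1 + a · u ⊗ uᵀJ_v` along a rational `u` the move of `reIm x` is `reIm (a h(u,x) u)`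
(`iota_symm_apply_reIm_of_val_eq`) and its phase is `½ (-(im a) N(z)) + ½ B(y, y)`, `z = h(u, x)`, `σ(z) z = N(z)`
(`reflection_phase_eq`); with the COERCIVITY of the norm form at a non-split place (`|N(z)| ≥ q^{-k₀} s(z)²`,
`UnitaryGroupLocalNormFormCoercive`) and the families `r_{u,t}` inside every open subgroup for `t ∈ 𝔭^{n₁}`, the choice
`t = -t₀ c_u / N(z)` (`ψ_v(t₀) ≠ 1`) along a basis vector `u = b_i` with `z` large gives a move of size `O(1/s(z))` and
phase `t₀ + O(1/s(z)²)` (`expansion_step`); for `w` far out some pairing `h(b_i, x)` is large by reconstruction from the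
rational orthogonal basis (`exists_expansion_of_isField`).

## References
* [MoeglinVignerasWaldspurger1987] C. Mœglin, M.-F. Vignéras, J.-L. Waldspurger, LNM 1291 (1987), Chap. 1 I.6, I.11, I.17; Chap. 2 II.8.
* [WeilBNT1967] A. Weil, *Basic Number Theory* (1967), Chap. II §1 (Def. 1, Prop. 1 and Cor. 1–2).
* [Howe1979] R. Howe, *θ-series and invariant theory*, Proc. Symp. Pure Math. 33.1 (1979), §2.
* [Dieudonne1971GroupesClassiques] J. Dieudonné, *La géométrie des groupes classiques* (1971), Chap. II §4.
-/

set_option autoImplicit false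

noncomputable section

open Matrix NumberField IsDedekindDomain Filter
open scoped NNReal Topology
open Literature.RepresentationTheory.HeisenbergGroup
open Literature.NumberTheory.GaloisRepresentations.IsNonarchimedeanLocalField
open Literature.NumberTheory.GelbartRogawski1991.UnitaryDualPair.LocalSplitting (iota iota_def localPairing localGram LocalSp)

namespace Literature.NumberTheory.Automorphic.UnitaryGroup
/-! ## §4 The expansion property -/

section Expansion

variable {F : Type} [Field F] [NumberField F] (E : Type) [Field E] [NumberField E] [Algebra F E]
  [Algebra.IsQuadraticExtension F E] (c : E ≃ₐ[F] E) {N : ℕ}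
  {δ : E} (hcδ : c δ = -δ) (hδ : δ ≠ 0) {d : F} (hd : δ * δ = algebraMap F E d)
  (T : Matrix (Fin N) (Fin N) F) (hT : T.IsSymm) (hTd : IsUnit T.det)
  {J : Matrix (Fin N) (Fin N) E} (hJ : J = T.map (algebraMap F E))
  (v : HeightOneSpectrum (𝓞 F))

/-- the Heisenberg phase of a symplectic move `g w = w + y`: `f_g(w) - B(w, y) = ½ A(y, w) + ½ B(y, y)` (`A = alt B`).
[cite: Weil1964, n° 5, pp. 150–151] -/
theorem ofSymplectic_f_sub_eq (g : LocalSp F N T v) (w y : (Fin N → v.adicCompletion F) × (Fin N → v.adicCompletion F))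
    (hg : g.1 w = w + y) :
    (ofSymplectic (polar (localPairing F N T v)) g).f w - polar (localPairing F N T v) w (g.1 w - w) =
      ⅟(2 : v.adicCompletion F) * alt (polar (localPairing F N T v)) y w +
        ⅟(2 : v.adicCompletion F) * polar (localPairing F N T v) y y := by
  have h2 : ⅟(2 : v.adicCompletion F) * 2 = 1 := invOf_mul_self _
  rw [ofSymplectic_f, hg, add_sub_cancel_left]
  simp only [map_add, LinearMap.add_apply, alt_apply]
  linear_combination (polar (localPairing F N T v) w y) * h2

/-- the bilinear term `B(reIm y, reIm y) = Σ_{k,l} re(y_k) T_{kl} im(y_l)` is quadratically small in the coordinates of `y`.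
[cite: WeilBNT1967, Chap. II §1 Def. 1] -/
theorem normAbs_polar_reIm_le (y : Fin N → UnitaryGroup.LocalRing E v) {Y : ℝ≥0}
    (hre : ∀ k, normAbs (v.adicCompletion F)
      (QuadraticCoordinates.re (quadraticLocalEquiv E v c hcδ hδ).toLinearEquiv.toAddEquiv (y k)) ≤ Y)
    (him : ∀ k, normAbs (v.adicCompletion F)
      (QuadraticCoordinates.im (quadraticLocalEquiv E v c hcδ hδ).toLinearEquiv.toAddEquiv (y k)) ≤ Y) :
    normAbs (v.adicCompletion F) (polar (localPairing F N T v)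
        (QuadraticCoordinates.reIm (quadraticLocalEquiv E v c hcδ hδ).toLinearEquiv.toAddEquiv (Fin N) y)
        (QuadraticCoordinates.reIm (quadraticLocalEquiv E v c hcδ hδ).toLinearEquiv.toAddEquiv (Fin N) y)) ≤
      (∑ k, ∑ l, normAbs (v.adicCompletion F) ((T k l : F) : v.adicCompletion F)) * Y * Y := by
  rw [polar_apply, Matrix.toLinearMap₂'_apply', dotProduct]
  refine normAbs_sum_le _ _ fun k _ => ?_
  rw [QuadraticCoordinates.reIm_apply_fst, mulVec, dotProduct, Finset.mul_sum]
  refine normAbs_sum_le _ _ fun l _ => ?_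
  rw [QuadraticCoordinates.reIm_apply_snd, show localGram F N T v k l = ((T k l : F) : v.adicCompletion F) from rfl,
    map_mul, map_mul]
  have hT1 : normAbs (v.adicCompletion F) ((T k l : F) : v.adicCompletion F) ≤
      ∑ k, ∑ l, normAbs (v.adicCompletion F) ((T k l : F) : v.adicCompletion F) :=
    (Finset.single_le_sum (f := fun l => normAbs (v.adicCompletion F) ((T k l : F) : v.adicCompletion F))
      (fun _ _ => zero_le) (Finset.mem_univ l)).trans
      (Finset.single_le_sum (f := fun k => ∑ l, normAbs (v.adicCompletion F) ((T k l : F) : v.adicCompletion F))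
        (fun _ _ => zero_le) (Finset.mem_univ k))
  rw [← mul_assoc]
  calc _ ≤ Y * (∑ k, ∑ l, normAbs (v.adicCompletion F) ((T k l : F) : v.adicCompletion F)) * Y :=
        mul_le_mul' (mul_le_mul' (hre k) hT1) (him l)
    _ = _ := by rw [mul_comm Y]

include hd hT hJ in
/-- the symplectic move of a quasi-reflection through `ι_v`: `ι_v(r) (reIm x) = reIm x + reIm (a h(u,x) u)`.
[cite: MoeglinVignerasWaldspurger1987, Ch. 1 I.17] -/
theorem iota_symm_apply_reIm_of_val_eq (u : Fin N → F) (x : Fin N → UnitaryGroup.LocalRing E v) (a : UnitaryGroup.LocalRing E v)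
    (g : UnitaryGroup.«local» E c N J v)
    (hg : (g : GL (Fin N) (UnitaryGroup.LocalRing E v)).val = 1 + a • vecMulVec (fun k => toLocalRing E v ((u k : F) : v.adicCompletion F)) ((fun k => toLocalRing E v ((u k : F) : v.adicCompletion F)) ᵥ* ((T.map (algebraMap F (v.adicCompletion F))).map (toLocalRing E v)))) :
    (iota F E c N hcδ hδ hd T hT hJ v ((UnitaryGroup.localPiEquiv E c N J v).symm g)).1 (QuadraticCoordinates.reIm (quadraticLocalEquiv E v c hcδ hδ).toLinearEquiv.toAddEquiv (Fin N) x) =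
      QuadraticCoordinates.reIm (quadraticLocalEquiv E v c hcδ hδ).toLinearEquiv.toAddEquiv (Fin N) x + QuadraticCoordinates.reIm (quadraticLocalEquiv E v c hcδ hδ).toLinearEquiv.toAddEquiv (Fin N) ((a * (((fun k => toLocalRing E v ((u k : F) : v.adicCompletion F)) ᵥ* ((T.map (algebraMap F (v.adicCompletion F))).map (toLocalRing E v))) ⬝ᵥ x)) • (fun k => toLocalRing E v ((u k : F) : v.adicCompletion F))) := by
  rw [iota_localPiEquiv_symm_reIm, hg, reflMatrix_mulVec, map_add]

include hd hT hJ in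
/-- **the Heisenberg phase of a quasi-reflection move**: with `z = h(u, x)`, `σ(z) z = φ(n_z)` and `y = a z u`,
`f_{ι_v r}(reIm x) - B(reIm x, ι_v(r)(reIm x) - reIm x) = ½ (-(im a) n_z) + ½ B(reIm y, reIm y)`.
[cite: MoeglinVignerasWaldspurger1987, Chap. 2 II.8] -/
theorem reflection_phase_eq (u : Fin N → F) (x : Fin N → UnitaryGroup.LocalRing E v) (a : UnitaryGroup.LocalRing E v)
    (g : UnitaryGroup.«local» E c N J v)
    (hg : (g : GL (Fin N) (UnitaryGroup.LocalRing E v)).val = 1 + a • vecMulVec (fun k => toLocalRing E v ((u k : F) : v.adicCompletion F)) ((fun k => toLocalRing E v ((u k : F) : v.adicCompletion F)) ᵥ* ((T.map (algebraMap F (v.adicCompletion F))).map (toLocalRing E v))))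
    (nz : v.adicCompletion F) (hnz : conjLocal E c v (((fun k => toLocalRing E v ((u k : F) : v.adicCompletion F)) ᵥ* ((T.map (algebraMap F (v.adicCompletion F))).map (toLocalRing E v))) ⬝ᵥ x) * (((fun k => toLocalRing E v ((u k : F) : v.adicCompletion F)) ᵥ* ((T.map (algebraMap F (v.adicCompletion F))).map (toLocalRing E v))) ⬝ᵥ x) = toLocalRing E v nz) :
    (ofSymplectic (polar (localPairing F N T v))
          (iota F E c N hcδ hδ hd T hT hJ v ((UnitaryGroup.localPiEquiv E c N J v).symm g))).f (QuadraticCoordinates.reIm (quadraticLocalEquiv E v c hcδ hδ).toLinearEquiv.toAddEquiv (Fin N) x) -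
        polar (localPairing F N T v) (QuadraticCoordinates.reIm (quadraticLocalEquiv E v c hcδ hδ).toLinearEquiv.toAddEquiv (Fin N) x)
          ((iota F E c N hcδ hδ hd T hT hJ v ((UnitaryGroup.localPiEquiv E c N J v).symm g)).1 (QuadraticCoordinates.reIm (quadraticLocalEquiv E v c hcδ hδ).toLinearEquiv.toAddEquiv (Fin N) x) - QuadraticCoordinates.reIm (quadraticLocalEquiv E v c hcδ hδ).toLinearEquiv.toAddEquiv (Fin N) x) =
      ⅟(2 : v.adicCompletion F) * (-(QuadraticCoordinates.im (quadraticLocalEquiv E v c hcδ hδ).toLinearEquiv.toAddEquiv a) * nz) +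
        ⅟(2 : v.adicCompletion F) * polar (localPairing F N T v) (QuadraticCoordinates.reIm (quadraticLocalEquiv E v c hcδ hδ).toLinearEquiv.toAddEquiv (Fin N) ((a * (((fun k => toLocalRing E v ((u k : F) : v.adicCompletion F)) ᵥ* ((T.map (algebraMap F (v.adicCompletion F))).map (toLocalRing E v))) ⬝ᵥ x)) • (fun k => toLocalRing E v ((u k : F) : v.adicCompletion F))))
          (QuadraticCoordinates.reIm (quadraticLocalEquiv E v c hcδ hδ).toLinearEquiv.toAddEquiv (Fin N) ((a * (((fun k => toLocalRing E v ((u k : F) : v.adicCompletion F)) ᵥ* ((T.map (algebraMap F (v.adicCompletion F))).map (toLocalRing E v))) ⬝ᵥ x)) • (fun k => toLocalRing E v ((u k : F) : v.adicCompletion F)))) := by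
  have hq := isQuadraticCoordinates_local E v c hcδ hδ hd
  have hmove := iota_symm_apply_reIm_of_val_eq E c hcδ hδ hd T hT hJ v u x a g hg
  have hu : ∀ k, conjLocal E c v ((fun k => toLocalRing E v ((u k : F) : v.adicCompletion F)) k) = (fun k => toLocalRing E v ((u k : F) : v.adicCompletion F)) k := fun k => conjLocal_toLocalRing c v _
  rw [ofSymplectic_f_sub_eq T v _ _ _ hmove, alt_polar_localPairing_reIm E c hcδ hδ hd T hT v, hermForm_smul_left,
    hermForm_eq_vecMul_dotProduct (conjLocal E c v) _ hu x, map_mul (conjLocal E c v), mul_assoc, hnz, hq.im_mul, hq.re_map,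
    hq.im_map, mul_zero, zero_add, im_conjLocal E c hcδ hδ hd v]

/-- the size of the reflection parameter: `|re a| |c_u| ≤ max(1,|d|) |t|` and `|im a| |c_u| ≤ max(1,|d|) |t|` for
`a = (2dt² + 2tδ)/(c_u(1 - dt²))`, `|dt²| < 1`, `|t| ≤ 1`. [cite: WeilBNT1967, Chap. II §1 Def. 1] -/
theorem reflParam_size_le (cu : F) (hcu : cu ≠ 0) (t : v.adicCompletion F)
    (hdt : normAbs (v.adicCompletion F) ((d : v.adicCompletion F) * t ^ 2) < 1) (ht1 : normAbs (v.adicCompletion F) t ≤ 1) :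
    normAbs (v.adicCompletion F) (QuadraticCoordinates.re (quadraticLocalEquiv E v c hcδ hδ).toLinearEquiv.toAddEquiv ((quadraticLocalEquiv E v c hcδ hδ)
        (2 * (d : v.adicCompletion F) * t ^ 2 / ((cu : v.adicCompletion F) * (1 - (d : v.adicCompletion F) * t ^ 2)),
          2 * t / ((cu : v.adicCompletion F) * (1 - (d : v.adicCompletion F) * t ^ 2))))) * normAbs (v.adicCompletion F) ((cu : F) : v.adicCompletion F) ≤
      max 1 (normAbs (v.adicCompletion F) (d : v.adicCompletion F)) * normAbs (v.adicCompletion F) t ∧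
    normAbs (v.adicCompletion F) (QuadraticCoordinates.im (quadraticLocalEquiv E v c hcδ hδ).toLinearEquiv.toAddEquiv ((quadraticLocalEquiv E v c hcδ hδ)
        (2 * (d : v.adicCompletion F) * t ^ 2 / ((cu : v.adicCompletion F) * (1 - (d : v.adicCompletion F) * t ^ 2)),
          2 * t / ((cu : v.adicCompletion F) * (1 - (d : v.adicCompletion F) * t ^ 2))))) * normAbs (v.adicCompletion F) ((cu : F) : v.adicCompletion F) ≤
      max 1 (normAbs (v.adicCompletion F) (d : v.adicCompletion F)) * normAbs (v.adicCompletion F) t := by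
  have hD : (1 : v.adicCompletion F) - (d : v.adicCompletion F) * t ^ 2 ≠ 0 := by
    intro h0
    have h1 : (d : v.adicCompletion F) * t ^ 2 = 1 := (sub_eq_zero.1 h0).symm
    rw [h1, map_one] at hdt
    exact lt_irrefl _ hdt
  have hD1 : normAbs (v.adicCompletion F) (1 - (d : v.adicCompletion F) * t ^ 2) = 1 := normAbs_one_sub_eq_one hdt
  have hcuK : (cu : v.adicCompletion F) ≠ 0 := by
    intro h0
    apply hcu
    apply (algebraMap F (v.adicCompletion F)).injective
    rw [map_zero]
    exact h0
  have h2 : normAbs (v.adicCompletion F) 2 ≤ 1 := by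
    have := normAbs_add_le_max (F := v.adicCompletion F) 1 1
    rw [map_one, max_self, one_add_one_eq_two] at this
    exact this
  have htt : normAbs (v.adicCompletion F) t * normAbs (v.adicCompletion F) t ≤ normAbs (v.adicCompletion F) t * 1 := mul_le_mul_right ht1 _
  have hre : QuadraticCoordinates.re (quadraticLocalEquiv E v c hcδ hδ).toLinearEquiv.toAddEquiv
      ((quadraticLocalEquiv E v c hcδ hδ)
        (2 * (d : v.adicCompletion F) * t ^ 2 / ((cu : v.adicCompletion F) * (1 - (d : v.adicCompletion F) * t ^ 2)),
          2 * t / ((cu : v.adicCompletion F) * (1 - (d : v.adicCompletion F) * t ^ 2)))) =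
      2 * (d : v.adicCompletion F) * t ^ 2 / ((cu : v.adicCompletion F) * (1 - (d : v.adicCompletion F) * t ^ 2)) := QuadraticCoordinates.re_apply _ _ _
  have him : QuadraticCoordinates.im (quadraticLocalEquiv E v c hcδ hδ).toLinearEquiv.toAddEquiv
      ((quadraticLocalEquiv E v c hcδ hδ)
        (2 * (d : v.adicCompletion F) * t ^ 2 / ((cu : v.adicCompletion F) * (1 - (d : v.adicCompletion F) * t ^ 2)),
          2 * t / ((cu : v.adicCompletion F) * (1 - (d : v.adicCompletion F) * t ^ 2)))) =
      2 * t / ((cu : v.adicCompletion F) * (1 - (d : v.adicCompletion F) * t ^ 2)) := QuadraticCoordinates.im_apply _ _ _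
  rw [hre, him]
  constructor
  · have : 2 * (d : v.adicCompletion F) * t ^ 2 / ((cu : v.adicCompletion F) * (1 - (d : v.adicCompletion F) * t ^ 2)) * (cu : v.adicCompletion F) =
        2 * ((d : v.adicCompletion F) * t ^ 2) / (1 - (d : v.adicCompletion F) * t ^ 2) := by
      field_simp
    rw [← map_mul, this, map_div₀, hD1, div_one, map_mul]
    calc normAbs (v.adicCompletion F) 2 * normAbs (v.adicCompletion F) ((d : v.adicCompletion F) * t ^ 2)
        ≤ 1 * (max 1 (normAbs (v.adicCompletion F) (d : v.adicCompletion F)) * (normAbs (v.adicCompletion F) t * 1)) := by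
          refine mul_le_mul' h2 ?_
          rw [map_mul, map_pow, sq]
          exact mul_le_mul' (le_max_right _ _) htt
      _ = _ := by rw [one_mul, mul_one]
  · have : 2 * t / ((cu : v.adicCompletion F) * (1 - (d : v.adicCompletion F) * t ^ 2)) * (cu : v.adicCompletion F) = 2 * t / (1 - (d : v.adicCompletion F) * t ^ 2) := by
      field_simp
    rw [← map_mul, this, map_div₀, hD1, div_one, map_mul]
    calc normAbs (v.adicCompletion F) 2 * normAbs (v.adicCompletion F) t ≤ 1 * (1 * normAbs (v.adicCompletion F) t) := by
          rw [one_mul]; exact mul_le_mul' h2 le_rfl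
      _ ≤ 1 * (max 1 (normAbs (v.adicCompletion F) (d : v.adicCompletion F)) * normAbs (v.adicCompletion F) t) :=
          mul_le_mul_right (mul_le_mul_left (le_max_left _ _) _) _
      _ = _ := one_mul _

include hd in
/-- the coordinates of the move `y = (a z) • u` for a rational `u`: `|re y_k| ≤ |u_k| max(1,|d|) s(a) s(z)` (and `im`).
[cite: WeilBNT1967, Chap. II §1 Def. 1] -/
theorem reIm_move_coord_le (u : Fin N → F) (a z : UnitaryGroup.LocalRing E v) (k : Fin N) {sa S : ℝ≥0}
    (hsa : normAbs (v.adicCompletion F) (QuadraticCoordinates.re (quadraticLocalEquiv E v c hcδ hδ).toLinearEquiv.toAddEquiv a) ≤ sa ∧ normAbs (v.adicCompletion F) (QuadraticCoordinates.im (quadraticLocalEquiv E v c hcδ hδ).toLinearEquiv.toAddEquiv a) ≤ sa)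
    (hS : normAbs (v.adicCompletion F) (QuadraticCoordinates.re (quadraticLocalEquiv E v c hcδ hδ).toLinearEquiv.toAddEquiv z) ≤ S ∧ normAbs (v.adicCompletion F) (QuadraticCoordinates.im (quadraticLocalEquiv E v c hcδ hδ).toLinearEquiv.toAddEquiv z) ≤ S) :
    normAbs (v.adicCompletion F) (QuadraticCoordinates.re (quadraticLocalEquiv E v c hcδ hδ).toLinearEquiv.toAddEquiv (((a * z) • (fun k => toLocalRing E v ((u k : F) : v.adicCompletion F))) k)) ≤
        normAbs (v.adicCompletion F) ((u k : F) : v.adicCompletion F) * (max 1 (normAbs (v.adicCompletion F) (d : v.adicCompletion F)) * sa * S) ∧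
      normAbs (v.adicCompletion F) (QuadraticCoordinates.im (quadraticLocalEquiv E v c hcδ hδ).toLinearEquiv.toAddEquiv (((a * z) • (fun k => toLocalRing E v ((u k : F) : v.adicCompletion F))) k)) ≤
        normAbs (v.adicCompletion F) ((u k : F) : v.adicCompletion F) * (max 1 (normAbs (v.adicCompletion F) (d : v.adicCompletion F)) * sa * S) := by
  have hq := isQuadraticCoordinates_local E v c hcδ hδ hd
  have hk : ((a * z) • (fun k => toLocalRing E v ((u k : F) : v.adicCompletion F))) k = toLocalRing E v ((u k : F) : v.adicCompletion F) * (a * z) := by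
    rw [Pi.smul_apply, smul_eq_mul, mul_comm]
  have hbd : max (normAbs (v.adicCompletion F) (QuadraticCoordinates.re (quadraticLocalEquiv E v c hcδ hδ).toLinearEquiv.toAddEquiv a)) (normAbs (v.adicCompletion F) (QuadraticCoordinates.im (quadraticLocalEquiv E v c hcδ hδ).toLinearEquiv.toAddEquiv a)) * max (normAbs (v.adicCompletion F) (QuadraticCoordinates.re (quadraticLocalEquiv E v c hcδ hδ).toLinearEquiv.toAddEquiv z)) (normAbs (v.adicCompletion F) (QuadraticCoordinates.im (quadraticLocalEquiv E v c hcδ hδ).toLinearEquiv.toAddEquiv z)) ≤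
      sa * S := mul_le_mul' (max_le hsa.1 hsa.2) (max_le hS.1 hS.2)
  rw [hk, hq.re_map_mul, hq.im_map_mul, map_mul (normAbs (v.adicCompletion F)), map_mul (normAbs (v.adicCompletion F))]
  constructor
  · refine mul_le_mul_right ((normAbs_re_mul_le E c hcδ hδ hd v a z).trans ?_) _
    rw [mul_assoc, mul_assoc]
    exact mul_le_mul_right hbd _
  · refine mul_le_mul_right ((normAbs_im_mul_le E c hcδ hδ hd v a z).trans ?_) _
    rw [mul_assoc, mul_assoc]
    exact mul_le_mul_right hbd _

include hcδ hδ hd hT hJ in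
/-- **the expansion step along ONE rational anisotropic vector** `u` (`uᵀTu = c_u ≠ 0`): if the pairing `z = h(u, x)` is
large compared with the constants of the problem (hypotheses `h2`–`h6`, `S ≥ max(|re z|, |im z|)`), and the norm form is
coercive at `z` (`hcoer`), then the quasi-reflection `r_{u,t}`, `t = -t₀ c_u / N(z)`, lies in `K`, moves `reIm x` into the box
`(𝔭^n)^{2N}` and has Heisenberg phase `ψ_v(t₀ + ε)` with `ε ∈ 𝔭^m`.  [cite: MoeglinVignerasWaldspurger1987, Chap. 2 II.8] -/
theorem expansion_step (u : Fin N → F) (cu : F) (hcu : cu ≠ 0)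
    (K : Subgroup (UnitaryGroup.localPi E c N J v)) (n m k₀ n₁ : ℤ) (hn₁0 : 0 ≤ n₁)
    (hn₁ : ∀ t ∈ primePowBall (v.adicCompletion F) n₁, normAbs (v.adicCompletion F) ((d : v.adicCompletion F) * t ^ 2) < 1 ∧
      ∃ g : UnitaryGroup.«local» E c N J v, (g : GL (Fin N) (UnitaryGroup.LocalRing E v)).val = 1 + ((quadraticLocalEquiv E v c hcδ hδ) (2 * (d : v.adicCompletion F) * t ^ 2 / ((cu : v.adicCompletion F) * (1 - (d : v.adicCompletion F) * t ^ 2)), 2 * t / ((cu : v.adicCompletion F) * (1 - (d : v.adicCompletion F) * t ^ 2)))) • vecMulVec (fun k => toLocalRing E v ((u k : F) : v.adicCompletion F)) ((fun k => toLocalRing E v ((u k : F) : v.adicCompletion F)) ᵥ* ((T.map (algebraMap F (v.adicCompletion F))).map (toLocalRing E v))) ∧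
        (UnitaryGroup.localPiEquiv E c N J v).symm g ∈ K)
    (t₀ : v.adicCompletion F) (ht₀ : adeleAddCharAt F v t₀ ≠ 1) (hm : ∀ y ∈ primePowBall (v.adicCompletion F) m, adeleAddCharAt F v y = 1)
    (x : Fin N → UnitaryGroup.LocalRing E v) (S Cu : ℝ≥0) (hS1 : 1 ≤ S)
    (hSre : normAbs (v.adicCompletion F) (QuadraticCoordinates.re (quadraticLocalEquiv E v c hcδ hδ).toLinearEquiv.toAddEquiv (((fun k => toLocalRing E v ((u k : F) : v.adicCompletion F)) ᵥ* ((T.map (algebraMap F (v.adicCompletion F))).map (toLocalRing E v))) ⬝ᵥ x)) ≤ S) (hSim : normAbs (v.adicCompletion F) (QuadraticCoordinates.im (quadraticLocalEquiv E v c hcδ hδ).toLinearEquiv.toAddEquiv (((fun k => toLocalRing E v ((u k : F) : v.adicCompletion F)) ᵥ* ((T.map (algebraMap F (v.adicCompletion F))).map (toLocalRing E v))) ⬝ᵥ x)) ≤ S)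
    (hcoer : ((residueFieldCard (v.adicCompletion F) : ℝ≥0)⁻¹) ^ k₀ * (S * S) ≤ normAbs (v.adicCompletion F) (QuadraticCoordinates.re (quadraticLocalEquiv E v c hcδ hδ).toLinearEquiv.toAddEquiv (((fun k => toLocalRing E v ((u k : F) : v.adicCompletion F)) ᵥ* ((T.map (algebraMap F (v.adicCompletion F))).map (toLocalRing E v))) ⬝ᵥ x) ^ 2 - (d : v.adicCompletion F) * QuadraticCoordinates.im (quadraticLocalEquiv E v c hcδ hδ).toLinearEquiv.toAddEquiv (((fun k => toLocalRing E v ((u k : F) : v.adicCompletion F)) ᵥ* ((T.map (algebraMap F (v.adicCompletion F))).map (toLocalRing E v))) ⬝ᵥ x) ^ 2))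
    (hCu : ∀ k, normAbs (v.adicCompletion F) ((u k : F) : v.adicCompletion F) ≤ Cu)
    (h2 : normAbs (v.adicCompletion F) t₀ * normAbs (v.adicCompletion F) ((cu : F) : v.adicCompletion F) * ((residueFieldCard (v.adicCompletion F) : ℝ≥0)⁻¹) ^ (-(n₁ + k₀)) ≤ S)
    (h4 : Cu * max 1 (normAbs (v.adicCompletion F) (d : v.adicCompletion F)) * max 1 (normAbs (v.adicCompletion F) (d : v.adicCompletion F)) * normAbs (v.adicCompletion F) t₀ * ((residueFieldCard (v.adicCompletion F) : ℝ≥0)⁻¹) ^ (-(k₀ + n)) ≤ S)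
    (h5 : normAbs (v.adicCompletion F) t₀ * normAbs (v.adicCompletion F) t₀ * max 1 (normAbs (v.adicCompletion F) (d : v.adicCompletion F)) * normAbs (v.adicCompletion F) ((cu : F) : v.adicCompletion F) * ((residueFieldCard (v.adicCompletion F) : ℝ≥0)⁻¹) ^ (-(m + k₀)) ≤ S)
    (h6 : normAbs (v.adicCompletion F) (⅟(2 : v.adicCompletion F)) * (∑ k, ∑ l, normAbs (v.adicCompletion F) ((T k l : F) : v.adicCompletion F)) *
      (Cu * max 1 (normAbs (v.adicCompletion F) (d : v.adicCompletion F)) * max 1 (normAbs (v.adicCompletion F) (d : v.adicCompletion F)) * normAbs (v.adicCompletion F) t₀ * ((residueFieldCard (v.adicCompletion F) : ℝ≥0)⁻¹) ^ (-k₀)) * (Cu * max 1 (normAbs (v.adicCompletion F) (d : v.adicCompletion F)) * max 1 (normAbs (v.adicCompletion F) (d : v.adicCompletion F)) * normAbs (v.adicCompletion F) t₀ * ((residueFieldCard (v.adicCompletion F) : ℝ≥0)⁻¹) ^ (-k₀)) * ((residueFieldCard (v.adicCompletion F) : ℝ≥0)⁻¹) ^ (-m) ≤ S) :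
    ∃ k ∈ K, ((iota F E c N hcδ hδ hd T hT hJ v k).1 (QuadraticCoordinates.reIm (quadraticLocalEquiv E v c hcδ hδ).toLinearEquiv.toAddEquiv (Fin N) x) - QuadraticCoordinates.reIm (quadraticLocalEquiv E v c hcδ hδ).toLinearEquiv.toAddEquiv (Fin N) x) ∈
        piPrimePowBall (v.adicCompletion F) (Fin N) n ×ˢ piPrimePowBall (v.adicCompletion F) (Fin N) n ∧
      adeleAddCharAt F v ((ofSymplectic (polar (localPairing F N T v)) (iota F E c N hcδ hδ hd T hT hJ v k)).f (QuadraticCoordinates.reIm (quadraticLocalEquiv E v c hcδ hδ).toLinearEquiv.toAddEquiv (Fin N) x) -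
        polar (localPairing F N T v) (QuadraticCoordinates.reIm (quadraticLocalEquiv E v c hcδ hδ).toLinearEquiv.toAddEquiv (Fin N) x) ((iota F E c N hcδ hδ hd T hT hJ v k).1 (QuadraticCoordinates.reIm (quadraticLocalEquiv E v c hcδ hδ).toLinearEquiv.toAddEquiv (Fin N) x) - QuadraticCoordinates.reIm (quadraticLocalEquiv E v c hcδ hδ).toLinearEquiv.toAddEquiv (Fin N) x)) ≠ 1 := by
  have hq := isQuadraticCoordinates_local E v c hcδ hδ hd
  -- the radius and its powers
  have hρ0 : (0 : ℝ≥0) < ((residueFieldCard (v.adicCompletion F) : ℝ≥0)⁻¹) := inv_residueFieldCard_pos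
  have hρ1 : ((residueFieldCard (v.adicCompletion F) : ℝ≥0)⁻¹) < 1 := inv_residueFieldCard_lt_one
  have hρk : ∀ k : ℤ, (0 : ℝ≥0) < ((residueFieldCard (v.adicCompletion F) : ℝ≥0)⁻¹) ^ k := fun k => zpow_pos hρ0 k
  have hρadd : ∀ a b : ℤ, ((residueFieldCard (v.adicCompletion F) : ℝ≥0)⁻¹) ^ (a + b) = ((residueFieldCard (v.adicCompletion F) : ℝ≥0)⁻¹) ^ a * ((residueFieldCard (v.adicCompletion F) : ℝ≥0)⁻¹) ^ b := fun a b => zpow_add₀ hρ0.ne' a b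
  have hS0 : 0 < S := lt_of_lt_of_le one_pos hS1
  have hSS : S ≤ S * S := by
    calc S = S * 1 := (mul_one S).symm
      _ ≤ S * S := mul_le_mul_right hS1 S
  have hD1 : (1 : ℝ≥0) ≤ max 1 (normAbs (v.adicCompletion F) (d : v.adicCompletion F)) := le_max_left _ _
  have hDd : normAbs (v.adicCompletion F) (d : v.adicCompletion F) ≤ max 1 (normAbs (v.adicCompletion F) (d : v.adicCompletion F)) := le_max_right _ _
  -- the norm `nz` of the pairing is non-zero
  have hnz_pos : 0 < normAbs (v.adicCompletion F) (QuadraticCoordinates.re (quadraticLocalEquiv E v c hcδ hδ).toLinearEquiv.toAddEquiv (((fun k => toLocalRing E v ((u k : F) : v.adicCompletion F)) ᵥ* ((T.map (algebraMap F (v.adicCompletion F))).map (toLocalRing E v))) ⬝ᵥ x) ^ 2 - (d : v.adicCompletion F) * QuadraticCoordinates.im (quadraticLocalEquiv E v c hcδ hδ).toLinearEquiv.toAddEquiv (((fun k => toLocalRing E v ((u k : F) : v.adicCompletion F)) ᵥ* ((T.map (algebraMap F (v.adicCompletion F))).map (toLocalRing E v))) ⬝ᵥ x) ^ 2) :=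
    lt_of_lt_of_le (mul_pos (hρk k₀) (mul_pos hS0 hS0)) hcoer
  have hnz0 : QuadraticCoordinates.re (quadraticLocalEquiv E v c hcδ hδ).toLinearEquiv.toAddEquiv (((fun k => toLocalRing E v ((u k : F) : v.adicCompletion F)) ᵥ* ((T.map (algebraMap F (v.adicCompletion F))).map (toLocalRing E v))) ⬝ᵥ x) ^ 2 - (d : v.adicCompletion F) * QuadraticCoordinates.im (quadraticLocalEquiv E v c hcδ hδ).toLinearEquiv.toAddEquiv (((fun k => toLocalRing E v ((u k : F) : v.adicCompletion F)) ᵥ* ((T.map (algebraMap F (v.adicCompletion F))).map (toLocalRing E v))) ⬝ᵥ x) ^ 2 ≠ 0 := fun h => hnz_pos.ne' (by rw [h, map_zero])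
  have hcuK : ((cu : F) : v.adicCompletion F) ≠ 0 := by
    intro h0
    apply hcu
    apply (algebraMap F (v.adicCompletion F)).injective
    rw [map_zero]
    exact h0
  have hcu_pos : 0 < normAbs (v.adicCompletion F) ((cu : F) : v.adicCompletion F) := pos_iff_ne_zero.2 ((map_ne_zero _).2 hcuK)
  -- the parameter `t = -t₀ c_u / nz`
  obtain ⟨t, ht⟩ : ∃ t : v.adicCompletion F, t = -(t₀ * ((cu : F) : v.adicCompletion F)) / (QuadraticCoordinates.re (quadraticLocalEquiv E v c hcδ hδ).toLinearEquiv.toAddEquiv (((fun k => toLocalRing E v ((u k : F) : v.adicCompletion F)) ᵥ* ((T.map (algebraMap F (v.adicCompletion F))).map (toLocalRing E v))) ⬝ᵥ x) ^ 2 - (d : v.adicCompletion F) * QuadraticCoordinates.im (quadraticLocalEquiv E v c hcδ hδ).toLinearEquiv.toAddEquiv (((fun k => toLocalRing E v ((u k : F) : v.adicCompletion F)) ᵥ* ((T.map (algebraMap F (v.adicCompletion F))).map (toLocalRing E v))) ⬝ᵥ x) ^ 2) := ⟨_, rfl⟩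
  have htnz : t * (QuadraticCoordinates.re (quadraticLocalEquiv E v c hcδ hδ).toLinearEquiv.toAddEquiv (((fun k => toLocalRing E v ((u k : F) : v.adicCompletion F)) ᵥ* ((T.map (algebraMap F (v.adicCompletion F))).map (toLocalRing E v))) ⬝ᵥ x) ^ 2 - (d : v.adicCompletion F) * QuadraticCoordinates.im (quadraticLocalEquiv E v c hcδ hδ).toLinearEquiv.toAddEquiv (((fun k => toLocalRing E v ((u k : F) : v.adicCompletion F)) ᵥ* ((T.map (algebraMap F (v.adicCompletion F))).map (toLocalRing E v))) ⬝ᵥ x) ^ 2) = -(t₀ * ((cu : F) : v.adicCompletion F)) := by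
    rw [ht]; exact div_mul_cancel₀ _ hnz0
  have hat_nz : normAbs (v.adicCompletion F) t * normAbs (v.adicCompletion F) (QuadraticCoordinates.re (quadraticLocalEquiv E v c hcδ hδ).toLinearEquiv.toAddEquiv (((fun k => toLocalRing E v ((u k : F) : v.adicCompletion F)) ᵥ* ((T.map (algebraMap F (v.adicCompletion F))).map (toLocalRing E v))) ⬝ᵥ x) ^ 2 - (d : v.adicCompletion F) * QuadraticCoordinates.im (quadraticLocalEquiv E v c hcδ hδ).toLinearEquiv.toAddEquiv (((fun k => toLocalRing E v ((u k : F) : v.adicCompletion F)) ᵥ* ((T.map (algebraMap F (v.adicCompletion F))).map (toLocalRing E v))) ⬝ᵥ x) ^ 2) = normAbs (v.adicCompletion F) t₀ * normAbs (v.adicCompletion F) ((cu : F) : v.adicCompletion F) := by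
    rw [← map_mul, htnz, normAbs_neg, map_mul]
  -- (a) `|t| ρ^{k₀} S² ≤ |t₀| |c_u|`, hence `|t| ≤ ρ^{n₁} ≤ 1`
  have ht_bound : normAbs (v.adicCompletion F) t * (((residueFieldCard (v.adicCompletion F) : ℝ≥0)⁻¹) ^ k₀ * (S * S)) ≤ normAbs (v.adicCompletion F) t₀ * normAbs (v.adicCompletion F) ((cu : F) : v.adicCompletion F) :=
    calc normAbs (v.adicCompletion F) t * (((residueFieldCard (v.adicCompletion F) : ℝ≥0)⁻¹) ^ k₀ * (S * S)) ≤ normAbs (v.adicCompletion F) t * normAbs (v.adicCompletion F) (QuadraticCoordinates.re (quadraticLocalEquiv E v c hcδ hδ).toLinearEquiv.toAddEquiv (((fun k => toLocalRing E v ((u k : F) : v.adicCompletion F)) ᵥ* ((T.map (algebraMap F (v.adicCompletion F))).map (toLocalRing E v))) ⬝ᵥ x) ^ 2 - (d : v.adicCompletion F) * QuadraticCoordinates.im (quadraticLocalEquiv E v c hcδ hδ).toLinearEquiv.toAddEquiv (((fun k => toLocalRing E v ((u k : F) : v.adicCompletion F)) ᵥ* ((T.map (algebraMap F (v.adicCompletion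 F))).map (toLocalRing E v))) ⬝ᵥ x) ^ 2) := mul_le_mul_right hcoer _
      _ = normAbs (v.adicCompletion F) t₀ * normAbs (v.adicCompletion F) ((cu : F) : v.adicCompletion F) := hat_nz
  have ht_ball : normAbs (v.adicCompletion F) t ≤ ((residueFieldCard (v.adicCompletion F) : ℝ≥0)⁻¹) ^ n₁ := by
    have h1 : normAbs (v.adicCompletion F) t₀ * normAbs (v.adicCompletion F) ((cu : F) : v.adicCompletion F) ≤ S * ((residueFieldCard (v.adicCompletion F) : ℝ≥0)⁻¹) ^ (n₁ + k₀) := by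
      have := mul_le_mul_left h2 (((residueFieldCard (v.adicCompletion F) : ℝ≥0)⁻¹) ^ (n₁ + k₀))
      rwa [mul_assoc, ← hρadd, neg_add_cancel, zpow_zero, mul_one] at this
    have h3 : normAbs (v.adicCompletion F) t * (((residueFieldCard (v.adicCompletion F) : ℝ≥0)⁻¹) ^ k₀ * (S * S)) ≤ ((residueFieldCard (v.adicCompletion F) : ℝ≥0)⁻¹) ^ n₁ * (((residueFieldCard (v.adicCompletion F) : ℝ≥0)⁻¹) ^ k₀ * (S * S)) := by
      calc _ ≤ normAbs (v.adicCompletion F) t₀ * normAbs (v.adicCompletion F) ((cu : F) : v.adicCompletion F) := ht_bound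
        _ ≤ S * ((residueFieldCard (v.adicCompletion F) : ℝ≥0)⁻¹) ^ (n₁ + k₀) := h1
        _ ≤ S * S * ((residueFieldCard (v.adicCompletion F) : ℝ≥0)⁻¹) ^ (n₁ + k₀) := mul_le_mul_left hSS _
        _ = ((residueFieldCard (v.adicCompletion F) : ℝ≥0)⁻¹) ^ n₁ * (((residueFieldCard (v.adicCompletion F) : ℝ≥0)⁻¹) ^ k₀ * (S * S)) := by rw [hρadd]; ring
    exact le_of_mul_le_mul_right h3 (mul_pos (hρk k₀) (mul_pos hS0 hS0))
  have ht1 : normAbs (v.adicCompletion F) t ≤ 1 := ht_ball.trans (zpow_le_one₀ hρ0 hρ1.le hn₁0)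
  -- (b) the quasi-reflection `r_{u,t}` in `K`
  obtain ⟨hdt, g, hgval, hgK⟩ := hn₁ t ((mem_primePowBall_iff).2 ht_ball)
  have hD₁0 : (1 : v.adicCompletion F) - (d : v.adicCompletion F) * t ^ 2 ≠ 0 := by
    intro h0
    have h1 : (d : v.adicCompletion F) * t ^ 2 = 1 := (sub_eq_zero.1 h0).symm
    rw [h1, map_one] at hdt
    exact lt_irrefl _ hdt
  have hD₁1 : normAbs (v.adicCompletion F) (1 - (d : v.adicCompletion F) * t ^ 2) = 1 := normAbs_one_sub_eq_one hdt
  -- (c) the size of the parameter `a = a(t)`: `s(a) |c_u| ≤ D |t|`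
  obtain ⟨hαs, hβs⟩ := reflParam_size_le E c hcδ hδ v cu hcu t hdt ht1
  obtain ⟨sa, hsa⟩ : ∃ sa : ℝ≥0, sa = max 1 (normAbs (v.adicCompletion F) (d : v.adicCompletion F)) * normAbs (v.adicCompletion F) t / normAbs (v.adicCompletion F) ((cu : F) : v.adicCompletion F) := ⟨_, rfl⟩
  have hsaR : normAbs (v.adicCompletion F) (QuadraticCoordinates.re (quadraticLocalEquiv E v c hcδ hδ).toLinearEquiv.toAddEquiv ((quadraticLocalEquiv E v c hcδ hδ) (2 * (d : v.adicCompletion F) * t ^ 2 / ((cu : v.adicCompletion F) * (1 - (d : v.adicCompletion F) * t ^ 2)), 2 * t / ((cu : v.adicCompletion F) * (1 - (d : v.adicCompletion F) * t ^ 2))))) ≤ sa := hsa ▸ (le_div_iff₀ hcu_pos).2 hαs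
  have hsaI : normAbs (v.adicCompletion F) (QuadraticCoordinates.im (quadraticLocalEquiv E v c hcδ hδ).toLinearEquiv.toAddEquiv ((quadraticLocalEquiv E v c hcδ hδ) (2 * (d : v.adicCompletion F) * t ^ 2 / ((cu : v.adicCompletion F) * (1 - (d : v.adicCompletion F) * t ^ 2)), 2 * t / ((cu : v.adicCompletion F) * (1 - (d : v.adicCompletion F) * t ^ 2))))) ≤ sa := hsa ▸ (le_div_iff₀ hcu_pos).2 hβs
  -- `|t| S² ≤ |t₀| |c_u| ρ^{-k₀}`
  have hkk : ((residueFieldCard (v.adicCompletion F) : ℝ≥0)⁻¹) ^ (-k₀) * ((residueFieldCard (v.adicCompletion F) : ℝ≥0)⁻¹) ^ k₀ = 1 := by rw [← hρadd, neg_add_cancel, zpow_zero]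
  have htS : normAbs (v.adicCompletion F) t * (S * S) ≤ normAbs (v.adicCompletion F) t₀ * normAbs (v.adicCompletion F) ((cu : F) : v.adicCompletion F) * ((residueFieldCard (v.adicCompletion F) : ℝ≥0)⁻¹) ^ (-k₀) := by
    calc normAbs (v.adicCompletion F) t * (S * S) = normAbs (v.adicCompletion F) t * (S * S) * (((residueFieldCard (v.adicCompletion F) : ℝ≥0)⁻¹) ^ (-k₀) * ((residueFieldCard (v.adicCompletion F) : ℝ≥0)⁻¹) ^ k₀) := by rw [hkk, mul_one]
      _ = normAbs (v.adicCompletion F) t * (((residueFieldCard (v.adicCompletion F) : ℝ≥0)⁻¹) ^ k₀ * (S * S)) * ((residueFieldCard (v.adicCompletion F) : ℝ≥0)⁻¹) ^ (-k₀) := by ring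
      _ ≤ normAbs (v.adicCompletion F) t₀ * normAbs (v.adicCompletion F) ((cu : F) : v.adicCompletion F) * ((residueFieldCard (v.adicCompletion F) : ℝ≥0)⁻¹) ^ (-k₀) := mul_le_mul_left ht_bound _
  -- the common bound `Y` of the coordinates of the move, with `Y S ≤ Cy`
  obtain ⟨Y, hY⟩ : ∃ Y : ℝ≥0, Y = Cu * (max 1 (normAbs (v.adicCompletion F) (d : v.adicCompletion F)) * sa * S) := ⟨_, rfl⟩
  obtain ⟨Cy, hCy⟩ : ∃ Cy : ℝ≥0, Cy = Cu * max 1 (normAbs (v.adicCompletion F) (d : v.adicCompletion F)) * max 1 (normAbs (v.adicCompletion F) (d : v.adicCompletion F)) * normAbs (v.adicCompletion F) t₀ * ((residueFieldCard (v.adicCompletion F) : ℝ≥0)⁻¹) ^ (-k₀) := ⟨_, rfl⟩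
  have hYS : Y * S ≤ Cy := by
    refine le_of_mul_le_mul_right ?_ hcu_pos
    have e1 : Y * S * normAbs (v.adicCompletion F) ((cu : F) : v.adicCompletion F) = Cu * max 1 (normAbs (v.adicCompletion F) (d : v.adicCompletion F)) * max 1 (normAbs (v.adicCompletion F) (d : v.adicCompletion F)) * (normAbs (v.adicCompletion F) t * (S * S)) := by
      rw [hY, hsa]
      calc Cu * (max 1 (normAbs (v.adicCompletion F) (d : v.adicCompletion F)) * (max 1 (normAbs (v.adicCompletion F) (d : v.adicCompletion F)) * normAbs (v.adicCompletion F) t / normAbs (v.adicCompletion F) ((cu : F) : v.adicCompletion F)) * S) * S * normAbs (v.adicCompletion F) ((cu : F) : v.adicCompletion F)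
          = Cu * max 1 (normAbs (v.adicCompletion F) (d : v.adicCompletion F)) * S * S * (max 1 (normAbs (v.adicCompletion F) (d : v.adicCompletion F)) * normAbs (v.adicCompletion F) t / normAbs (v.adicCompletion F) ((cu : F) : v.adicCompletion F) * normAbs (v.adicCompletion F) ((cu : F) : v.adicCompletion F)) := by ring
        _ = Cu * max 1 (normAbs (v.adicCompletion F) (d : v.adicCompletion F)) * S * S * (max 1 (normAbs (v.adicCompletion F) (d : v.adicCompletion F)) * normAbs (v.adicCompletion F) t) := by rw [div_mul_cancel₀ _ hcu_pos.ne']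
        _ = _ := by ring
    rw [e1, hCy]
    calc Cu * max 1 (normAbs (v.adicCompletion F) (d : v.adicCompletion F)) * max 1 (normAbs (v.adicCompletion F) (d : v.adicCompletion F)) * (normAbs (v.adicCompletion F) t * (S * S))
        ≤ Cu * max 1 (normAbs (v.adicCompletion F) (d : v.adicCompletion F)) * max 1 (normAbs (v.adicCompletion F) (d : v.adicCompletion F)) * (normAbs (v.adicCompletion F) t₀ * normAbs (v.adicCompletion F) ((cu : F) : v.adicCompletion F) * ((residueFieldCard (v.adicCompletion F) : ℝ≥0)⁻¹) ^ (-k₀)) := mul_le_mul_right htS _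
      _ = _ := by ring
  have hCyS : Cy ≤ ((residueFieldCard (v.adicCompletion F) : ℝ≥0)⁻¹) ^ n * S := by
    have := mul_le_mul_left h4 (((residueFieldCard (v.adicCompletion F) : ℝ≥0)⁻¹) ^ (k₀ + n))
    rw [mul_assoc, ← hρadd, neg_add_cancel, zpow_zero, mul_one] at this
    rw [hCy]
    calc Cu * max 1 (normAbs (v.adicCompletion F) (d : v.adicCompletion F)) * max 1 (normAbs (v.adicCompletion F) (d : v.adicCompletion F)) * normAbs (v.adicCompletion F) t₀ * ((residueFieldCard (v.adicCompletion F) : ℝ≥0)⁻¹) ^ (-k₀)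
        = Cu * max 1 (normAbs (v.adicCompletion F) (d : v.adicCompletion F)) * max 1 (normAbs (v.adicCompletion F) (d : v.adicCompletion F)) * normAbs (v.adicCompletion F) t₀ * (((residueFieldCard (v.adicCompletion F) : ℝ≥0)⁻¹) ^ (-k₀) * ((residueFieldCard (v.adicCompletion F) : ℝ≥0)⁻¹) ^ k₀) * ((residueFieldCard (v.adicCompletion F) : ℝ≥0)⁻¹) ^ (-k₀) := by rw [hkk, mul_one]
      _ = Cu * max 1 (normAbs (v.adicCompletion F) (d : v.adicCompletion F)) * max 1 (normAbs (v.adicCompletion F) (d : v.adicCompletion F)) * normAbs (v.adicCompletion F) t₀ * ((residueFieldCard (v.adicCompletion F) : ℝ≥0)⁻¹) ^ (-k₀) * (((residueFieldCard (v.adicCompletion F) : ℝ≥0)⁻¹) ^ k₀ * ((residueFieldCard (v.adicCompletion F) : ℝ≥0)⁻¹) ^ (-k₀)) := by ring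
      _ ≤ S * ((residueFieldCard (v.adicCompletion F) : ℝ≥0)⁻¹) ^ (k₀ + n) * ((residueFieldCard (v.adicCompletion F) : ℝ≥0)⁻¹) ^ (-k₀) := by
          rw [← hρadd, add_neg_cancel, zpow_zero, mul_one]; exact mul_le_mul_left this _
      _ = ((residueFieldCard (v.adicCompletion F) : ℝ≥0)⁻¹) ^ n * S := by rw [hρadd]; calc S * (((residueFieldCard (v.adicCompletion F) : ℝ≥0)⁻¹) ^ k₀ * ((residueFieldCard (v.adicCompletion F) : ℝ≥0)⁻¹) ^ n) * ((residueFieldCard (v.adicCompletion F) : ℝ≥0)⁻¹) ^ (-k₀)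
            = ((residueFieldCard (v.adicCompletion F) : ℝ≥0)⁻¹) ^ n * S * (((residueFieldCard (v.adicCompletion F) : ℝ≥0)⁻¹) ^ (-k₀) * ((residueFieldCard (v.adicCompletion F) : ℝ≥0)⁻¹) ^ k₀) := by ring
          _ = ((residueFieldCard (v.adicCompletion F) : ℝ≥0)⁻¹) ^ n * S := by rw [hkk, mul_one]
  have hYn : Y ≤ ((residueFieldCard (v.adicCompletion F) : ℝ≥0)⁻¹) ^ n := le_of_mul_le_mul_right (hYS.trans hCyS) hS0
  have hcoord : ∀ k, normAbs (v.adicCompletion F) (QuadraticCoordinates.re (quadraticLocalEquiv E v c hcδ hδ).toLinearEquiv.toAddEquiv (((((quadraticLocalEquiv E v c hcδ hδ) (2 * (d : v.adicCompletion F) * t ^ 2 / ((cu : v.adicCompletion F) * (1 - (d : v.adicCompletion F) * t ^ 2)), 2 * t / ((cu : v.adicCompletion F) * (1 - (d : v.adicCompletion F) * t ^ 2)))) * (((fun k => toLocalRing E v ((u k : F) : v.adicCompletion F)) ᵥ* ((T.map (algebraMap F (v.adicCompletion F))).map (toLocalRing E v))) ⬝ᵥ x)) • (fun k => toLocalRing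 E v ((u k : F) : v.adicCompletion F))) k)) ≤ Y ∧ normAbs (v.adicCompletion F) (QuadraticCoordinates.im (quadraticLocalEquiv E v c hcδ hδ).toLinearEquiv.toAddEquiv (((((quadraticLocalEquiv E v c hcδ hδ) (2 * (d : v.adicCompletion F) * t ^ 2 / ((cu : v.adicCompletion F) * (1 - (d : v.adicCompletion F) * t ^ 2)), 2 * t / ((cu : v.adicCompletion F) * (1 - (d : v.adicCompletion F) * t ^ 2)))) * (((fun k => toLocalRing E v ((u k : F) : v.adicCompletion F)) ᵥ* ((T.map (algebraMap F (v.adicCompletion F))).map (toLocalRing E v))) ⬝ᵥ x)) • (fun k => toLocalRing E v ((u k : F) : v.adicCompletion F))) k)) ≤ Y := by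
    intro k
    obtain ⟨h1, h2⟩ := reIm_move_coord_le E c hcδ hδ hd v u ((quadraticLocalEquiv E v c hcδ hδ) (2 * (d : v.adicCompletion F) * t ^ 2 / ((cu : v.adicCompletion F) * (1 - (d : v.adicCompletion F) * t ^ 2)), 2 * t / ((cu : v.adicCompletion F) * (1 - (d : v.adicCompletion F) * t ^ 2)))) (((fun k => toLocalRing E v ((u k : F) : v.adicCompletion F)) ᵥ* ((T.map (algebraMap F (v.adicCompletion F))).map (toLocalRing E v))) ⬝ᵥ x) k ⟨hsaR, hsaI⟩ ⟨hSre, hSim⟩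
    rw [hY]
    exact ⟨h1.trans (mul_le_mul_left (hCu k) _), h2.trans (mul_le_mul_left (hCu k) _)⟩
  have hmove := iota_symm_apply_reIm_of_val_eq E c hcδ hδ hd T hT hJ v u x _ g hgval
  refine ⟨(UnitaryGroup.localPiEquiv E c N J v).symm g, hgK, ?_, ?_⟩
  · -- the move lies in the box `(𝔭^n)^{2N}`
    rw [hmove, add_sub_cancel_left, Set.mem_prod, mem_piPrimePowBall_iff, mem_piPrimePowBall_iff]
    refine ⟨fun k => ?_, fun k => ?_⟩
    · rw [mem_primePowBall_iff, QuadraticCoordinates.reIm_apply_fst]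
      exact (hcoord k).1.trans hYn
    · rw [mem_primePowBall_iff, QuadraticCoordinates.reIm_apply_snd]
      exact (hcoord k).2.trans hYn
  · -- the phase is `ψ(t₀ + ε)` with `ε ∈ 𝔭^m`
    have hnz_eq : conjLocal E c v (((fun k => toLocalRing E v ((u k : F) : v.adicCompletion F)) ᵥ* ((T.map (algebraMap F (v.adicCompletion F))).map (toLocalRing E v))) ⬝ᵥ x) * (((fun k => toLocalRing E v ((u k : F) : v.adicCompletion F)) ᵥ* ((T.map (algebraMap F (v.adicCompletion F))).map (toLocalRing E v))) ⬝ᵥ x) = toLocalRing E v (QuadraticCoordinates.re (quadraticLocalEquiv E v c hcδ hδ).toLinearEquiv.toAddEquiv (((fun k => toLocalRing E v ((u k : F) : v.adicCompletion F)) ᵥ* ((T.map (algebraMap F (v.adicCompletion F))).map (toLocalRing E v))) ⬝ᵥ x) ^ 2 - (d : v.adicCompletion F) * QuadraticCoordinates.im (quadraticLocalEquiv E v c hcδ hδ).toLinearEquiv.toAddEquiv (((fun k => toLocalRing E v ((u k : F) : v.adicCompletion F)) ᵥ* ((T.map (algebraMap F (v.adicCompletion F))).map (toLocalRing E v))) ⬝ᵥ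 x) ^ 2) :=
      conjLocal_mul_self E c hcδ hδ hd v _
    rw [reflection_phase_eq E c hcδ hδ hd T hT hJ v u x _ g hgval _ hnz_eq]
    have him : QuadraticCoordinates.im (quadraticLocalEquiv E v c hcδ hδ).toLinearEquiv.toAddEquiv ((quadraticLocalEquiv E v c hcδ hδ) (2 * (d : v.adicCompletion F) * t ^ 2 / ((cu : v.adicCompletion F) * (1 - (d : v.adicCompletion F) * t ^ 2)), 2 * t / ((cu : v.adicCompletion F) * (1 - (d : v.adicCompletion F) * t ^ 2)))) = 2 * t / ((cu : v.adicCompletion F) * (1 - (d : v.adicCompletion F) * t ^ 2)) := QuadraticCoordinates.im_apply _ _ _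
    rw [him]
    -- algebra: `½ (-(2t/(c_u D₁)) n_z) = t₀ / D₁ = t₀ + t₀ d t² / D₁`
    have halg : ⅟(2 : v.adicCompletion F) * (-(2 * t / ((cu : v.adicCompletion F) * (1 - (d : v.adicCompletion F) * t ^ 2))) * (QuadraticCoordinates.re (quadraticLocalEquiv E v c hcδ hδ).toLinearEquiv.toAddEquiv (((fun k => toLocalRing E v ((u k : F) : v.adicCompletion F)) ᵥ* ((T.map (algebraMap F (v.adicCompletion F))).map (toLocalRing E v))) ⬝ᵥ x) ^ 2 - (d : v.adicCompletion F) * QuadraticCoordinates.im (quadraticLocalEquiv E v c hcδ hδ).toLinearEquiv.toAddEquiv (((fun k => toLocalRing E v ((u k : F) : v.adicCompletion F)) ᵥ* ((T.map (algebraMap F (v.adicCompletion F))).map (toLocalRing E v))) ⬝ᵥ x) ^ 2)) =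
        t₀ + t₀ * ((d : v.adicCompletion F) * t ^ 2) / (1 - (d : v.adicCompletion F) * t ^ 2) := by
      have h2inv : ⅟(2 : v.adicCompletion F) * 2 = 1 := invOf_mul_self _
      have e1 : ⅟(2 : v.adicCompletion F) * (-(2 * t / ((cu : v.adicCompletion F) * (1 - (d : v.adicCompletion F) * t ^ 2))) *
          (QuadraticCoordinates.re (quadraticLocalEquiv E v c hcδ hδ).toLinearEquiv.toAddEquiv (((fun k => toLocalRing E v ((u k : F) : v.adicCompletion F)) ᵥ* ((T.map (algebraMap F (v.adicCompletion F))).map (toLocalRing E v))) ⬝ᵥ x) ^ 2 - (d : v.adicCompletion F) * QuadraticCoordinates.im (quadraticLocalEquiv E v c hcδ hδ).toLinearEquiv.toAddEquiv (((fun k => toLocalRing E v ((u k : F) : v.adicCompletion F)) ᵥ* ((T.map (algebraMap F (v.adicCompletion F))).map (toLocalRing E v))) ⬝ᵥ x) ^ 2)) =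
          -((⅟(2 : v.adicCompletion F) * 2) * (t * (QuadraticCoordinates.re (quadraticLocalEquiv E v c hcδ hδ).toLinearEquiv.toAddEquiv (((fun k => toLocalRing E v ((u k : F) : v.adicCompletion F)) ᵥ* ((T.map (algebraMap F (v.adicCompletion F))).map (toLocalRing E v))) ⬝ᵥ x) ^ 2 - (d : v.adicCompletion F) * QuadraticCoordinates.im (quadraticLocalEquiv E v c hcδ hδ).toLinearEquiv.toAddEquiv (((fun k => toLocalRing E v ((u k : F) : v.adicCompletion F)) ᵥ* ((T.map (algebraMap F (v.adicCompletion F))).map (toLocalRing E v))) ⬝ᵥ x) ^ 2))) / ((cu : v.adicCompletion F) * (1 - (d : v.adicCompletion F) * t ^ 2)) := by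
        ring
      rw [e1, h2inv, one_mul, htnz, neg_neg, mul_comm t₀, mul_div_mul_left _ _ hcuK, div_eq_iff hD₁0, add_mul,
        div_mul_cancel₀ _ hD₁0]
      ring
    rw [halg, add_assoc, AddChar.map_add_eq_mul]
    -- `ε ∈ 𝔭^m`
    have hε : t₀ * ((d : v.adicCompletion F) * t ^ 2) / (1 - (d : v.adicCompletion F) * t ^ 2) +
        ⅟(2 : v.adicCompletion F) * polar (localPairing F N T v) (QuadraticCoordinates.reIm (quadraticLocalEquiv E v c hcδ hδ).toLinearEquiv.toAddEquiv (Fin N) ((((quadraticLocalEquiv E v c hcδ hδ) (2 * (d : v.adicCompletion F) * t ^ 2 / ((cu : v.adicCompletion F) * (1 - (d : v.adicCompletion F) * t ^ 2)), 2 * t / ((cu : v.adicCompletion F) * (1 - (d : v.adicCompletion F) * t ^ 2)))) * (((fun k => toLocalRing E v ((u k : F) : v.adicCompletion F)) ᵥ* ((T.map (algebraMap F (v.adicCompletion F))).map (toLocalRing E v))) ⬝ᵥ x)) • (fun k => toLocalRing E v ((u k : F) : v.adicCompletion F)))) (QuadraticCoordinates.reIm (quadraticLocalEquiv E v c hcδ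 hδ).toLinearEquiv.toAddEquiv (Fin N) ((((quadraticLocalEquiv E v c hcδ hδ) (2 * (d : v.adicCompletion F) * t ^ 2 / ((cu : v.adicCompletion F) * (1 - (d : v.adicCompletion F) * t ^ 2)), 2 * t / ((cu : v.adicCompletion F) * (1 - (d : v.adicCompletion F) * t ^ 2)))) * (((fun k => toLocalRing E v ((u k : F) : v.adicCompletion F)) ᵥ* ((T.map (algebraMap F (v.adicCompletion F))).map (toLocalRing E v))) ⬝ᵥ x)) • (fun k => toLocalRing E v ((u k : F) : v.adicCompletion F)))) ∈
        primePowBall (v.adicCompletion F) m := by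
      rw [mem_primePowBall_iff]
      refine (normAbs_add_le_max _ _).trans (max_le ?_ ?_)
      · -- `|t₀ d t² / D₁| = |t₀| |d| |t|² ≤ |t₀| D |t| ≤ ρ^m`
        rw [map_div₀, hD₁1, div_one, map_mul, map_mul, map_pow, sq]
        have hle : normAbs (v.adicCompletion F) t₀ * (normAbs (v.adicCompletion F) (d : v.adicCompletion F) * (normAbs (v.adicCompletion F) t * normAbs (v.adicCompletion F) t)) ≤ normAbs (v.adicCompletion F) t₀ * max 1 (normAbs (v.adicCompletion F) (d : v.adicCompletion F)) * normAbs (v.adicCompletion F) t := by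
          calc _ ≤ normAbs (v.adicCompletion F) t₀ * (max 1 (normAbs (v.adicCompletion F) (d : v.adicCompletion F)) * (normAbs (v.adicCompletion F) t * 1)) := mul_le_mul_right (mul_le_mul' hDd (mul_le_mul_right ht1 _)) _
            _ = _ := by ring
        refine hle.trans (le_of_mul_le_mul_right ?_ (mul_pos (hρk k₀) (mul_pos hS0 hS0)))
        have := mul_le_mul_left h5 (((residueFieldCard (v.adicCompletion F) : ℝ≥0)⁻¹) ^ (m + k₀))
        rw [mul_assoc, ← hρadd, neg_add_cancel, zpow_zero, mul_one] at this
        calc normAbs (v.adicCompletion F) t₀ * max 1 (normAbs (v.adicCompletion F) (d : v.adicCompletion F)) * normAbs (v.adicCompletion F) t * (((residueFieldCard (v.adicCompletion F) : ℝ≥0)⁻¹) ^ k₀ * (S * S)) = normAbs (v.adicCompletion F) t₀ * max 1 (normAbs (v.adicCompletion F) (d : v.adicCompletion F)) * (normAbs (v.adicCompletion F) t * (((residueFieldCard (v.adicCompletion F) : ℝ≥0)⁻¹) ^ k₀ * (S * S))) := by ring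
          _ ≤ normAbs (v.adicCompletion F) t₀ * max 1 (normAbs (v.adicCompletion F) (d : v.adicCompletion F)) * (normAbs (v.adicCompletion F) t₀ * normAbs (v.adicCompletion F) ((cu : F) : v.adicCompletion F)) := mul_le_mul_right ht_bound _
          _ = normAbs (v.adicCompletion F) t₀ * normAbs (v.adicCompletion F) t₀ * max 1 (normAbs (v.adicCompletion F) (d : v.adicCompletion F)) * normAbs (v.adicCompletion F) ((cu : F) : v.adicCompletion F) := by ring
          _ ≤ S * ((residueFieldCard (v.adicCompletion F) : ℝ≥0)⁻¹) ^ (m + k₀) := this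
          _ ≤ S * S * ((residueFieldCard (v.adicCompletion F) : ℝ≥0)⁻¹) ^ (m + k₀) := mul_le_mul_left hSS _
          _ = ((residueFieldCard (v.adicCompletion F) : ℝ≥0)⁻¹) ^ m * (((residueFieldCard (v.adicCompletion F) : ℝ≥0)⁻¹) ^ k₀ * (S * S)) := by rw [hρadd]; ring
      · -- `|½ B(y', y')| ≤ |½| C_T Y² ≤ ρ^m`
        rw [map_mul]
        have hB := normAbs_polar_reIm_le E c hcδ hδ T v ((((quadraticLocalEquiv E v c hcδ hδ) (2 * (d : v.adicCompletion F) * t ^ 2 / ((cu : v.adicCompletion F) * (1 - (d : v.adicCompletion F) * t ^ 2)), 2 * t / ((cu : v.adicCompletion F) * (1 - (d : v.adicCompletion F) * t ^ 2)))) * (((fun k => toLocalRing E v ((u k : F) : v.adicCompletion F)) ᵥ* ((T.map (algebraMap F (v.adicCompletion F))).map (toLocalRing E v))) ⬝ᵥ x)) • (fun k => toLocalRing E v ((u k : F) : v.adicCompletion F))) (fun k => (hcoord k).1) (fun k => (hcoord k).2)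
        refine (mul_le_mul_right hB _).trans (le_of_mul_le_mul_right ?_ (mul_pos hS0 hS0))
        have := mul_le_mul_left h6 (((residueFieldCard (v.adicCompletion F) : ℝ≥0)⁻¹) ^ m)
        rw [mul_assoc, ← hρadd, neg_add_cancel, zpow_zero, mul_one, ← hCy] at this
        calc normAbs (v.adicCompletion F) (⅟(2 : v.adicCompletion F)) * ((∑ k, ∑ l, normAbs (v.adicCompletion F) ((T k l : F) : v.adicCompletion F)) * Y * Y) * (S * S)
            = normAbs (v.adicCompletion F) (⅟(2 : v.adicCompletion F)) * (∑ k, ∑ l, normAbs (v.adicCompletion F) ((T k l : F) : v.adicCompletion F)) * (Y * S) * (Y * S) := by ring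
          _ ≤ normAbs (v.adicCompletion F) (⅟(2 : v.adicCompletion F)) * (∑ k, ∑ l, normAbs (v.adicCompletion F) ((T k l : F) : v.adicCompletion F)) * Cy * Cy :=
              mul_le_mul' (mul_le_mul_right hYS _) hYS
          _ ≤ S * ((residueFieldCard (v.adicCompletion F) : ℝ≥0)⁻¹) ^ m := this
          _ ≤ S * S * ((residueFieldCard (v.adicCompletion F) : ℝ≥0)⁻¹) ^ m := mul_le_mul_left hSS _
          _ = ((residueFieldCard (v.adicCompletion F) : ℝ≥0)⁻¹) ^ m * (S * S) := mul_comm _ _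
    rw [hm _ hε, mul_one]
    exact ht₀

set_option maxHeartbeats 400000 in
include hcδ hδ hd hT hTd hJ in
/-- **THE EXPANSION PROPERTY at a non-split place.**  Let `E_v` be a field, `K ≤ U(J)(F_v)` an open subgroup and `n ∈ ℤ`.
There is `M` such that every `w ∈ 𝕎_v = F_vᴺ × F_vᴺ` outside the box `(𝔭^M)^N × (𝔭^M)^N` is moved by some `k ∈ K` with
`ι_v(k) w - w ∈ (𝔭^n)^N × (𝔭^n)^N` and `ψ_v(f_{ι_v k}(w) - B(w, ι_v(k) w - w)) ≠ 1`.  Group-side input of the lattice-model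
support bound for the theta lift from the compact `U(1)`; it is exactly here that `v` non-split enters.
[cite: MoeglinVignerasWaldspurger1987, Chap. 2 II.8] [cite: Howe1979, §2] -/
theorem exists_expansion_of_isField (hE : IsField (UnitaryGroup.LocalRing E v))
    (K : Subgroup (UnitaryGroup.localPi E c N J v)) (hK : IsOpen (K : Set (UnitaryGroup.localPi E c N J v))) (n : ℤ) :
    ∃ M : ℤ, ∀ w : (Fin N → v.adicCompletion F) × (Fin N → v.adicCompletion F),
      w ∉ piPrimePowBall (v.adicCompletion F) (Fin N) M ×ˢ piPrimePowBall (v.adicCompletion F) (Fin N) M →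
      ∃ k ∈ K, ((iota F E c N hcδ hδ hd T hT hJ v k).1 w - w) ∈
          piPrimePowBall (v.adicCompletion F) (Fin N) n ×ˢ piPrimePowBall (v.adicCompletion F) (Fin N) n ∧
        adeleAddCharAt F v ((ofSymplectic (polar (localPairing F N T v)) (iota F E c N hcδ hδ hd T hT hJ v k)).f w -
          polar (localPairing F N T v) w ((iota F E c N hcδ hδ hd T hT hJ v k).1 w - w)) ≠ 1 := by
  classical
  have hq := isQuadraticCoordinates_local E v c hcδ hδ hd
  -- the radius `ρ = q⁻¹`
  obtain ⟨ρ, hρ⟩ : ∃ ρ : ℝ≥0, ρ = ((residueFieldCard (v.adicCompletion F) : ℝ≥0)⁻¹) := ⟨_, rfl⟩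
  have hρ0 : 0 < ρ := hρ ▸ inv_residueFieldCard_pos
  have hρ1 : ρ < 1 := hρ ▸ inv_residueFieldCard_lt_one
  have hball : ∀ (k : ℤ) (y : v.adicCompletion F), y ∈ primePowBall (v.adicCompletion F) k ↔ normAbs (v.adicCompletion F) y ≤ ρ ^ k := fun k y => by
    rw [mem_primePowBall_iff, hρ]
  -- a rational orthogonal basis and the size constants
  obtain ⟨b, cb, Q, hcb, hbb, -, hQ⟩ := exists_orthogonal_rows T hT hTd
  obtain ⟨CQ, hCQ⟩ : ∃ C : ℝ≥0, C = max 1 (∑ j, ∑ i, normAbs (v.adicCompletion F) ((Q j i : F) : v.adicCompletion F)) := ⟨_, rfl⟩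
  obtain ⟨Cb, hCb⟩ : ∃ C : ℝ≥0, C = ∑ i, ∑ k, normAbs (v.adicCompletion F) ((b i k : F) : v.adicCompletion F) := ⟨_, rfl⟩
  obtain ⟨Cc, hCc⟩ : ∃ C : ℝ≥0, C = ∑ i, normAbs (v.adicCompletion F) ((cb i : F) : v.adicCompletion F) := ⟨_, rfl⟩
  have hQle : ∀ j i, normAbs (v.adicCompletion F) ((Q j i : F) : v.adicCompletion F) ≤ CQ := fun j i => hCQ ▸
    ((Finset.single_le_sum (f := fun i => normAbs (v.adicCompletion F) ((Q j i : F) : v.adicCompletion F))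
      (fun _ _ => zero_le) (Finset.mem_univ i)).trans
      (Finset.single_le_sum (f := fun j => ∑ i, normAbs (v.adicCompletion F) ((Q j i : F) : v.adicCompletion F))
        (fun _ _ => zero_le) (Finset.mem_univ j))).trans (le_max_right _ _)
  have hble : ∀ i k, normAbs (v.adicCompletion F) ((b i k : F) : v.adicCompletion F) ≤ Cb := fun i k => hCb ▸
    (Finset.single_le_sum (f := fun k => normAbs (v.adicCompletion F) ((b i k : F) : v.adicCompletion F))
      (fun _ _ => zero_le) (Finset.mem_univ k)).trans
      (Finset.single_le_sum (f := fun i => ∑ k, normAbs (v.adicCompletion F) ((b i k : F) : v.adicCompletion F))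
        (fun _ _ => zero_le) (Finset.mem_univ i))
  have hcble : ∀ i, normAbs (v.adicCompletion F) ((cb i : F) : v.adicCompletion F) ≤ Cc := fun i => hCc ▸
    Finset.single_le_sum (f := fun i => normAbs (v.adicCompletion F) ((cb i : F) : v.adicCompletion F)) (fun _ _ => zero_le) (Finset.mem_univ i)
  -- coercivity of the norm form, the conductor `m` and `t₀` with `ψ_v(t₀) ≠ 1`
  obtain ⟨k₀, hk₀⟩ := exists_coercivity_of_isField E c hcδ hδ hd v hE
  obtain ⟨m, hm⟩ := (isContinuousNontrivial_adeleAddCharAt F v).exists_hasConductorExp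
  obtain ⟨t₀, -, ht₀⟩ := hm.2
  -- reflections along each `b i` inside `K` for `t ∈ 𝔭^{ns}`
  have hcu : ∀ i, (b i ᵥ* T) ⬝ᵥ b i ≠ 0 := fun i => by rw [hbb i]; exact hcb i
  choose n₁ hn₁ using fun i => exists_ball_reflection_mem E c hcδ hδ hd T hT hJ v (b i) (hcu i) K hK
  obtain ⟨ns, hns⟩ : ∃ ns : ℤ, ns = ∑ i, |n₁ i| := ⟨_, rfl⟩
  have hns0 : 0 ≤ ns := hns ▸ Finset.sum_nonneg fun i _ => abs_nonneg _
  have hnsi : ∀ i, n₁ i ≤ ns := fun i => hns ▸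
    (le_abs_self _).trans (Finset.single_le_sum (f := fun i => |n₁ i|) (fun i _ => abs_nonneg _) (Finset.mem_univ i))
  -- one threshold `A` above all the constants of `expansion_step`
  obtain ⟨A, hA1, hA2, hA4, hA5, hA6⟩ : ∃ A : ℝ≥0, 1 ≤ A ∧ normAbs (v.adicCompletion F) t₀ * Cc * ρ ^ (-(ns + k₀)) ≤ A ∧
      Cb * max 1 (normAbs (v.adicCompletion F) (d : v.adicCompletion F)) * max 1 (normAbs (v.adicCompletion F) (d : v.adicCompletion F)) * normAbs (v.adicCompletion F) t₀ * ρ ^ (-(k₀ + n)) ≤ A ∧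
      normAbs (v.adicCompletion F) t₀ * normAbs (v.adicCompletion F) t₀ * max 1 (normAbs (v.adicCompletion F) (d : v.adicCompletion F)) * Cc * ρ ^ (-(m + k₀)) ≤ A ∧
      normAbs (v.adicCompletion F) (⅟(2 : v.adicCompletion F)) * (∑ k, ∑ l, normAbs (v.adicCompletion F) ((T k l : F) : v.adicCompletion F)) *
        (Cb * max 1 (normAbs (v.adicCompletion F) (d : v.adicCompletion F)) * max 1 (normAbs (v.adicCompletion F) (d : v.adicCompletion F)) * normAbs (v.adicCompletion F) t₀ * ρ ^ (-k₀)) * (Cb * max 1 (normAbs (v.adicCompletion F) (d : v.adicCompletion F)) * max 1 (normAbs (v.adicCompletion F) (d : v.adicCompletion F)) * normAbs (v.adicCompletion F) t₀ * ρ ^ (-k₀)) * ρ ^ (-m) ≤ A :=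
    ⟨1 + normAbs (v.adicCompletion F) t₀ * Cc * ρ ^ (-(ns + k₀)) + Cb * max 1 (normAbs (v.adicCompletion F) (d : v.adicCompletion F)) * max 1 (normAbs (v.adicCompletion F) (d : v.adicCompletion F)) * normAbs (v.adicCompletion F) t₀ * ρ ^ (-(k₀ + n)) +
        normAbs (v.adicCompletion F) t₀ * normAbs (v.adicCompletion F) t₀ * max 1 (normAbs (v.adicCompletion F) (d : v.adicCompletion F)) * Cc * ρ ^ (-(m + k₀)) +
        normAbs (v.adicCompletion F) (⅟(2 : v.adicCompletion F)) * (∑ k, ∑ l, normAbs (v.adicCompletion F) ((T k l : F) : v.adicCompletion F)) *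
          (Cb * max 1 (normAbs (v.adicCompletion F) (d : v.adicCompletion F)) * max 1 (normAbs (v.adicCompletion F) (d : v.adicCompletion F)) * normAbs (v.adicCompletion F) t₀ * ρ ^ (-k₀)) * (Cb * max 1 (normAbs (v.adicCompletion F) (d : v.adicCompletion F)) * max 1 (normAbs (v.adicCompletion F) (d : v.adicCompletion F)) * normAbs (v.adicCompletion F) t₀ * ρ ^ (-k₀)) * ρ ^ (-m),
      le_self_add.trans (le_self_add.trans (le_self_add.trans le_self_add)),
      le_add_self.trans (le_self_add.trans (le_self_add.trans le_self_add)),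
      le_add_self.trans (le_self_add.trans le_self_add), le_add_self.trans le_self_add, le_add_self⟩
  -- the box `Ω = (𝔭^{-M'})^{2N}` with `q^{M'} > CQ · A`
  obtain ⟨M', hM'⟩ := pow_unbounded_of_one_lt (CQ * A) ((one_lt_inv_iff₀.2 ⟨hρ0, hρ1⟩ : (1 : ℝ≥0) < ρ⁻¹))
  have hρM : ρ ^ (-(M' : ℤ)) = ρ⁻¹ ^ M' := by rw [_root_.zpow_neg, zpow_natCast, inv_pow]
  refine ⟨-(M' : ℤ), fun w hw => ?_⟩
  -- a coordinate of `x = reIm⁻¹ w` is large, hence some pairing `h(b_i, x)` is large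
  obtain ⟨x, hxw⟩ : ∃ x : Fin N → UnitaryGroup.LocalRing E v, QuadraticCoordinates.reIm (quadraticLocalEquiv E v c hcδ hδ).toLinearEquiv.toAddEquiv (Fin N) x = w := ⟨_, (QuadraticCoordinates.reIm (quadraticLocalEquiv E v c hcδ hδ).toLinearEquiv.toAddEquiv (Fin N)).apply_symm_apply w⟩
  rw [← hxw]
  obtain ⟨j, hj⟩ : ∃ j, ρ ^ (-(M' : ℤ)) < max (normAbs (v.adicCompletion F) (QuadraticCoordinates.re (quadraticLocalEquiv E v c hcδ hδ).toLinearEquiv.toAddEquiv (x j))) (normAbs (v.adicCompletion F) (QuadraticCoordinates.im (quadraticLocalEquiv E v c hcδ hδ).toLinearEquiv.toAddEquiv (x j))) := by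
    by_contra hcon
    push Not at hcon
    apply hw
    rw [Set.mem_prod, mem_piPrimePowBall_iff, mem_piPrimePowBall_iff]
    constructor
    · intro j
      rw [hball, ← hxw, QuadraticCoordinates.reIm_apply_fst]
      exact (le_max_left _ _).trans (hcon j)
    · intro j
      rw [hball, ← hxw, QuadraticCoordinates.reIm_apply_snd]
      exact (le_max_right _ _).trans (hcon j)
  have hrecon := apply_eq_sum_mul_vecMul_dotProduct E T v hQ x j
  obtain ⟨i, hi⟩ : ∃ i, A < max
      (normAbs (v.adicCompletion F) (QuadraticCoordinates.re (quadraticLocalEquiv E v c hcδ hδ).toLinearEquiv.toAddEquiv (((fun k => toLocalRing E v ((b i k : F) : v.adicCompletion F)) ᵥ*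
        (T.map (algebraMap F (v.adicCompletion F))).map (toLocalRing E v)) ⬝ᵥ x)))
      (normAbs (v.adicCompletion F) (QuadraticCoordinates.im (quadraticLocalEquiv E v c hcδ hδ).toLinearEquiv.toAddEquiv (((fun k => toLocalRing E v ((b i k : F) : v.adicCompletion F)) ᵥ*
        (T.map (algebraMap F (v.adicCompletion F))).map (toLocalRing E v)) ⬝ᵥ x))) := by
    by_contra hcon
    push Not at hcon
    have hsmall : max (normAbs (v.adicCompletion F) (QuadraticCoordinates.re (quadraticLocalEquiv E v c hcδ hδ).toLinearEquiv.toAddEquiv (x j))) (normAbs (v.adicCompletion F) (QuadraticCoordinates.im (quadraticLocalEquiv E v c hcδ hδ).toLinearEquiv.toAddEquiv (x j))) ≤ CQ * A := by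
      refine max_le ?_ ?_
      · rw [hrecon, map_sum]
        refine normAbs_sum_le _ _ fun i _ => ?_
        rw [hq.re_map_mul, map_mul]
        exact mul_le_mul' (hQle j i) ((le_max_left _ _).trans (hcon i))
      · rw [hrecon, map_sum]
        refine normAbs_sum_le _ _ fun i _ => ?_
        rw [hq.im_map_mul, map_mul]
        exact mul_le_mul' (hQle j i) ((le_max_right _ _).trans (hcon i))
    have : ρ ^ (-(M' : ℤ)) < ρ ^ (-(M' : ℤ)) := calc
      ρ ^ (-(M' : ℤ)) < _ := hj
      _ ≤ CQ * A := hsmall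
      _ < ρ⁻¹ ^ M' := hM'
      _ = ρ ^ (-(M' : ℤ)) := hρM.symm
    exact lt_irrefl _ this
  -- apply the expansion step along `b i`
  have hcoer := hk₀
    (QuadraticCoordinates.re (quadraticLocalEquiv E v c hcδ hδ).toLinearEquiv.toAddEquiv (((fun k => toLocalRing E v ((b i k : F) : v.adicCompletion F)) ᵥ* (T.map (algebraMap F (v.adicCompletion F))).map (toLocalRing E v)) ⬝ᵥ x))
    (QuadraticCoordinates.im (quadraticLocalEquiv E v c hcδ hδ).toLinearEquiv.toAddEquiv (((fun k => toLocalRing E v ((b i k : F) : v.adicCompletion F)) ᵥ* (T.map (algebraMap F (v.adicCompletion F))).map (toLocalRing E v)) ⬝ᵥ x))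
  rw [sq (max _ _)] at hcoer
  subst hρ
  refine expansion_step E c hcδ hδ hd T hT hJ v (b i) ((b i ᵥ* T) ⬝ᵥ b i) (hcu i) K n m k₀ ns hns0
    (fun t ht => hn₁ i t (primePowBall_antitone (hnsi i) ht)) t₀ ht₀ hm.1 x _ Cb (hA1.trans hi.le)
    (le_max_left _ _) (le_max_right _ _) hcoer (hble i) ?_ (hA4.trans hi.le) ?_ (hA6.trans hi.le)
  · have hc : normAbs (v.adicCompletion F) (((b i ᵥ* T) ⬝ᵥ b i : F) : v.adicCompletion F) ≤ Cc := by
      rw [hbb i]; exact hcble i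
    exact (mul_le_mul_left (mul_le_mul_right hc _) _).trans (hA2.trans hi.le)
  · have hc : normAbs (v.adicCompletion F) (((b i ᵥ* T) ⬝ᵥ b i : F) : v.adicCompletion F) ≤ Cc := by
      rw [hbb i]; exact hcble i
    exact (mul_le_mul_left (mul_le_mul_right hc _) _).trans (hA5.trans hi.le)

end Expansion

end Literature.NumberTheory.Automorphic.UnitaryGroup

end
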